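import Literature.Probability.RandomPlanarGeometry.LoopConfigurationsBlind
import Literature.Probability.Percolation.SiteLoopDensity
import HarnessLib

/-!
# Blind closeness already matches the small loops in `d_CN` (stub S4 of line `pinch-resampling`, brick B4)

Crux `Summit.CriticalPhenomena.CardyFormulaZ2.Theses.CardyMagicRigidity.NestingRigidity`
(stmt-CriticalPhenomena-4835), line `pinch-resampling` v2, registered stub
`stub_tomographicTransfer : FourArmCouplingT → FourArmCouplingZ2 → LoopLimitZ2Blind → LoopLimitZ2EqT`.
A deterministic, purely metric reduction of the UPGRADE "blind closeness ⇒ `d_CN`-closeness" to the macroscopic loops: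
if two typed configurations are blind-close at precision `ε` (`LoopConfig.IsBlindClose`: every loop in the window
`B(0, 1/ε)` has a same-type partner with `ε`-Hausdorff-close trace and equal winding interior off the `ε`-collar) and
`8 ε ≤ η`, then DKKMO's relation `IsClose η` (`udist`-partners for every loop in the smaller window `B(0, 1/η)`) holds
as soon as the loops of diameter `≥ η/8` of either configuration in that window have `udist`-partners at precision `η`:

* `udist_le_of_blindNear_of_diam_le` — a loop of diameter `≤ d` and a loop blind-close to it at precision `ε ≥ 0`
  have both traces in a closed ball of radius `d + ε`, hence are at `udist ≤ 2 (d + ε)`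
  (`UnbasedLoop.udist_le_of_subset_closedBall`): for SMALL loops the routing is invisible to `d_CN` as well;
* **`isClose_of_isBlindClose_of_forall_big`** (registered anchor) — the reduction above.

So in the tomographic transfer only the macroscopic loops (finitely many, tight) need their routing re-coupled; the
small loops come for free from the blind coupling (no density argument is even needed, in contrast with
`isClose_of_dense_of_forall_big` of `…IsCloseReduction`).  Lattice-free; no percolation object is mentioned.
-/

noncomputable section

namespace Summit.CriticalPhenomena.CardyFormulaZ2.Cruxes.NestingRigidity.PinchResampling

open Set Metric Literature.Probability.RandomPlanarGeometry

/-- **Small loops: blind-close implies `udist`-close.**  If `u` has trace of diameter `≤ d` and `u'` is blind-close to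
`u` at precision `ε ≥ 0`, then `udist u u' ≤ 2 (d + ε)`: pick `z` on the trace of `u`; the trace of `u` lies in
`closedBall z d`, every point of the trace of `u'` is within `ε` of the trace of `u`
(`BlindNear.exists_mem_range_dist_le`), so both traces lie in `closedBall z (d + ε)` and
`UnbasedLoop.udist_le_of_subset_closedBall` applies. -/
theorem udist_le_of_blindNear_of_diam_le {ε d : ℝ} (hε : 0 ≤ ε) {u u' : UnbasedLoop ℂ} (hd : diam u.range ≤ d)
    (h : BlindNear ε u u') : u.udist u' ≤ 2 * (d + ε) := by
  obtain ⟨z, hz⟩ := u.range_nonempty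
  have hd0 : 0 ≤ d := diam_nonneg.trans hd
  have hu : u.range ⊆ closedBall z (d + ε) := fun x hx ↦ by
    rw [mem_closedBall]
    calc dist x z ≤ diam u.range := dist_le_diam_of_mem u.isCompact_range.isBounded hx hz
      _ ≤ d + ε := hd.trans (le_add_of_nonneg_right hε)
  have hu' : u'.range ⊆ closedBall z (d + ε) := fun x hx ↦ by
    obtain ⟨y, hy, hxy⟩ := h.exists_mem_range_dist_le hε hx
    rw [mem_closedBall]
    calc dist x z ≤ dist x y + dist y z := dist_triangle _ _ _
      _ ≤ ε + diam u.range := add_le_add hxy (dist_le_diam_of_mem u.isCompact_range.isBounded hy hz)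
      _ ≤ d + ε := by linarith
  exact UnbasedLoop.udist_le_of_subset_closedBall (by positivity) hu hu'

/-- One type, one direction of the reduction: if every loop of `A` in `B(0, 1/ε)` has a blind partner in `B` at
precision `ε`, `0 < ε`, `8 ε ≤ η`, and every loop of `A` in `B(0, 1/η)` of diameter `≥ η/8` has a `udist`-partner in
`B` at precision `η`, then every loop of `A` in `B(0, 1/η)` has a `udist`-partner in `B` at precision `η`. -/
theorem forall_exists_udist_le_of_blind_of_forall_big {ε η : ℝ} (hε : 0 < ε) (hεη : 8 * ε ≤ η)
    {A B : Set (UnbasedLoop ℂ)}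
    (hblind : ∀ u ∈ A, u.range ⊆ ball (0 : ℂ) (1 / ε) → ∃ u' ∈ B, BlindNear ε u u')
    (hbig : ∀ u ∈ A, u.range ⊆ ball (0 : ℂ) (1 / η) → η / 8 ≤ diam u.range → ∃ u' ∈ B, u.udist u' ≤ η) :
    ∀ u ∈ A, u.range ⊆ ball (0 : ℂ) (1 / η) → ∃ u' ∈ B, u.udist u' ≤ η := by
  intro u hu hw
  by_cases hdiam : η / 8 ≤ diam u.range
  · exact hbig u hu hw hdiam
  · rw [not_le] at hdiam
    have hη : 0 < η := by linarith
    have hball : ball (0 : ℂ) (1 / η) ⊆ ball 0 (1 / ε) :=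
      ball_subset_ball (one_div_le_one_div_of_le hε (by linarith))
    obtain ⟨u', hu', hb⟩ := hblind u hu (hw.trans hball)
    refine ⟨u', hu', (udist_le_of_blindNear_of_diam_le hε.le hdiam.le hb).trans ?_⟩
    linarith

/-- **Blind closeness at precision `ε ≤ η/8` plus `udist`-matching of the big loops give `d_CN ≤ η`** (registered
anchor; brick B4 of stub S4).  For two typed loop configurations `c`, `c'` with `IsBlindClose ε c c'`, `0 < ε`,
`8 ε ≤ η`: if every loop of either configuration with trace in `B(0, 1/η)` and of diameter `≥ η/8` has a same-type
partner in the other configuration at `udist ≤ η`, then `IsClose η c c'`.  (The small loops are matched by their blind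
partners, `udist_le_of_blindNear_of_diam_le`; the windows nest because `ε ≤ η`.) -/
theorem isClose_of_isBlindClose_of_forall_big : ∀ {ε η : ℝ} {c c' : LoopConfig ℂ}, 0 < ε → 8 * ε ≤ η → LoopConfig.IsBlindClose ε c c' → (∀ i : Fin 2, ∀ u ∈ c.F i, u.range ⊆ Metric.ball (0 : ℂ) (1 / η) → η / 8 ≤ Metric.diam u.range → ∃ u' ∈ c'.F i, u.udist u' ≤ η) → (∀ i : Fin 2, ∀ u' ∈ c'.F i, u'.range ⊆ Metric.ball (0 : ℂ) (1 / η) → η / 8 ≤ Metric.diam u'.range → ∃ u ∈ c.F i, u'.udist u ≤ η) → LoopConfig.IsClose η c c' := by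
  intro ε η c c' hε hεη hblind hbig hbig' i
  exact ⟨forall_exists_udist_le_of_blind_of_forall_big hε hεη (hblind i).1 (hbig i),
    forall_exists_udist_le_of_blind_of_forall_big hε hεη (hblind i).2 (hbig' i)⟩

/-- The same reduction read on the BAD events of a coupling: the failure set of `IsClose η` is contained in the union of
the failure set of `IsBlindClose ε` and the failure set of the big-loop matching — so a coupling good for the blind data
in which the macroscopic loops have been `udist`-matched (the routing re-coupling of the transfer) is good for `d_CN`. -/
theorem setOf_not_isClose_subset {Ω : Type*} {ε η : ℝ} (hε : 0 < ε) (hεη : 8 * ε ≤ η) (X X' : Ω → LoopConfig ℂ) :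
    {ω | ¬ LoopConfig.IsClose η (X ω) (X' ω)} ⊆
      {ω | ¬ LoopConfig.IsBlindClose ε (X ω) (X' ω)} ∪
      {ω | ¬ ((∀ i : Fin 2, ∀ u ∈ (X ω).F i, u.range ⊆ ball (0 : ℂ) (1 / η) → η / 8 ≤ diam u.range →
          ∃ u' ∈ (X' ω).F i, u.udist u' ≤ η) ∧
        (∀ i : Fin 2, ∀ u' ∈ (X' ω).F i, u'.range ⊆ ball (0 : ℂ) (1 / η) → η / 8 ≤ diam u'.range →
          ∃ u ∈ (X ω).F i, u'.udist u ≤ η))} := by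
  intro ω hω
  by_contra hcon
  simp only [mem_union, mem_setOf_eq, not_or, not_not] at hcon
  exact hω (isClose_of_isBlindClose_of_forall_big hε hεη hcon.1 hcon.2.1 hcon.2.2)

end Summit.CriticalPhenomena.CardyFormulaZ2.Cruxes.NestingRigidity.PinchResampling

end
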